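import Mathlib
import Literature.Geometry.Symplectic.JHolomorphicSheetDichotomy
import Literature.Geometry.Symplectic.SheetIntersectionPersist
import HarnessLib

/-!
# A non-nested double point of a `J`-holomorphic map survives `C¹`-small perturbation

McDuff (1991), §4–5 (Lemma 4.3 with Thm 1.1: a transverse or tangential double point of a
`J`-holomorphic curve contributes positively to the self-intersection number, which is stable
under `C¹`-small perturbation), in the local form needed for "limits of embedded curves are
embedded": let `G : ℂ → F` (`dim F = 4`, `J` a smooth operator field) be smooth, `J`-holomorphic
near `z₁` and near `z₂`, immersed at `z₁`, with `G z₂ = G z₁`, and assume the double point is NOT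
NESTED — there is no germ of continuous map `a` at `z₂` with `a z₂ = z₁` and `G = G ∘ a` near `z₂`
(for instance, `z₁ ≠ z₂` and `G` injective near … is not required; nestedness is exactly the first
branch of `sheet_dichotomy`). If `u n → G` uniformly near `z₂` and in `C¹` near `z₁`, then for all
large `n` the map `u n` takes the same value at a point `η`-close to `z₂` and a point `η`-close to
`z₁` (`eventually_exists_eq_near_doublePoint`); in particular, when `z₁ ≠ z₂`, `u n` is not
injective for `n` large.

Proof: `sheet_dichotomy` (the nested branch is excluded by hypothesis) gives an isolated zero of
positive winding number for the normal coordinate of `G` near `z₂` in the sheet chart of `G` at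
`z₁`; `eventually_exists_eq_of_wind_ne_zero` (persistence) does the rest.

## References

* D. McDuff, *The local behaviour of holomorphic curves in almost complex 4-manifolds*,
  J. Differential Geom. 34 (1991), Thm 1.1, Lemma 4.3, §5. [McDuff1991LocalBehaviour]
-/

noncomputable section

open scoped ContDiff Topology
open Set Function Metric Filter
open Literature.Topology.PlaneTopology

namespace Literature.Geometry.Symplectic

variable {F : Type*} [NormedAddCommGroup F] [NormedSpace ℝ F] [FiniteDimensional ℝ F]

/-- **A non-nested double point of a `J`-holomorphic map persists under perturbations that are
`C⁰`-small near one branch and `C¹`-small near the other (immersed) branch.** See the module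
docstring. [cite: McDuff1991LocalBehaviour, Thm 1.1 and Lemma 4.3] -/
theorem eventually_exists_eq_near_doublePoint (h4 : Module.finrank ℝ F = 4)
    {J : F → F →L[ℝ] F} (hJ : ContDiff ℝ ∞ J) {G : ℂ → F} (hG : ContDiff ℝ ∞ G)
    {z₁ z₂ : ℂ} {R : ℝ} (hR : 0 < R)
    (hGJ₁ : ∀ z ∈ ball z₁ R, ∀ α : ℂ, fderiv ℝ G z (Complex.I * α) = J (G z) (fderiv ℝ G z α))
    (hJ2 : ∀ z ∈ ball z₁ R, ∀ w : F, J (G z) (J (G z) w) = -w)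
    (hinj : Injective (fderiv ℝ G z₁))
    (hGJ₂ : ∀ z ∈ ball z₂ R, ∀ α : ℂ, fderiv ℝ G z (Complex.I * α) = J (G z) (fderiv ℝ G z α))
    (hx : G z₂ = G z₁)
    (hnn : ¬ ∃ a : ℂ → ℂ, ContinuousAt a z₂ ∧ a z₂ = z₁ ∧ ∀ᶠ ζ in 𝓝 z₂, G ζ = G (a ζ))
    {u : ℕ → ℂ → F}
    (hu₁ : TendstoUniformlyOn u G atTop (closedBall z₁ R))
    (hdu₁ : TendstoUniformlyOn (fun n z => fderiv ℝ (u n) z) (fun z => fderiv ℝ G z) atTop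
      (closedBall z₁ R))
    (hud : ∀ᶠ n in atTop, ∀ z ∈ closedBall z₁ R, DifferentiableAt ℝ (u n) z)
    (hu₂ : TendstoUniformlyOn u G atTop (closedBall z₂ R))
    (huc : ∀ᶠ n in atTop, ContinuousOn (u n) (closedBall z₂ R))
    {η : ℝ} (hη : 0 < η) :
    ∀ᶠ n in atTop, ∃ ζ' ζ : ℂ, ‖ζ' - z₂‖ ≤ η ∧ ‖ζ - z₁‖ < η ∧ u n ζ' = u n ζ := by
  -- the dichotomy in the sheet chart of `G` at `z₁`
  obtain ⟨ν₀, e, ρ₀, hcoe, hsrc, hsymm, hρ₀, hvt, hdich⟩ :=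
    sheet_dichotomy h4 hJ hR hR hG hGJ₁ hJ2 hinj hG hGJ₂ hx
  -- `e.symm (G z₂) = (z₁, 0)`
  have hsx : e.symm (G z₂) = (z₁, 0) := by
    rw [hx, ← sheetChart_mk_zero J G ν₀ z₁, ← hcoe]
    exact e.left_inv hsrc
  have hxt : G z₂ ∈ e.target := hvt z₂ (mem_ball_self hρ₀)
  -- the nested branch is excluded
  have hiso : ∃ ε : ℝ, 0 < ε ∧ ε < ρ₀ ∧
      (∀ ζ : ℂ, 0 < ‖ζ - z₂‖ → ‖ζ - z₂‖ ≤ ε → (e.symm (G ζ)).2 ≠ 0) ∧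
      ∀ ε' : ℝ, 0 < ε' → ε' ≤ ε → 0 < wind (fun t => (e.symm (G (circleLoop z₂ ε' t))).2) := by
    refine hdich.resolve_left fun hzero => hnn ⟨fun ζ => (e.symm (G ζ)).1, ?_, ?_, ?_⟩
    · exact continuousAt_fst.comp ((e.continuousAt_symm hxt).comp hG.continuous.continuousAt)
    · simp only [hsx]
    · filter_upwards [hzero, isOpen_ball.mem_nhds (mem_ball_self hρ₀)] with ζ h2 hζ
      exact eq_sheet_of_snd_symm_eq_zero hcoe (hvt ζ hζ) h2
  obtain ⟨ε, hε, hερ₀, hne, hwind⟩ := hiso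
  -- a radius `δ₁` about `z₁`: axis points in the source, inside `B(z₁, R)`, and `δ₁ < η`
  obtain ⟨δ₁, hδ₁, hδ₁src, hδ₁R, hδ₁η⟩ : ∃ δ₁ : ℝ, 0 < δ₁ ∧
      (∀ z ∈ closedBall z₁ δ₁, ((z, 0) : ℂ × ℂ) ∈ e.source) ∧ δ₁ < R ∧ δ₁ < η := by
    have hc : ContinuousAt (fun z : ℂ => ((z, 0) : ℂ × ℂ)) z₁ := by fun_prop
    obtain ⟨δ, hδ, hδb⟩ := Metric.eventually_nhds_iff_ball.1
      (hc.preimage_mem_nhds (e.open_source.mem_nhds hsrc))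
    refine ⟨min (δ / 2) (min (R / 2) (η / 2)), by positivity, fun z hz => hδb z ?_, ?_, ?_⟩
    · exact closedBall_subset_ball (by
        have := min_le_left (δ / 2) (min (R / 2) (η / 2)); linarith) hz
    · have := (min_le_right (δ / 2) _).trans (min_le_left (R / 2) (η / 2)); linarith
    · have := (min_le_right (δ / 2) _).trans (min_le_right (R / 2) (η / 2)); linarith
  have hD₁R : closedBall z₁ δ₁ ⊆ closedBall z₁ R := closedBall_subset_closedBall hδ₁R.le
  -- data of the first sheet `b := G` on `B̄(z₁, δ₁)`
  have hbsrc : ∀ z ∈ closedBall z₁ δ₁, ((z, 0) : ℂ × ℂ) ∈ e.source ∧ e (z, 0) = G z :=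
    fun z hz => ⟨hδ₁src z hz, by rw [hcoe, sheetChart_mk_zero]⟩
  have hbd : ∀ z ∈ closedBall z₁ δ₁, DifferentiableAt ℝ G z := fun z _ =>
    (hG.differentiable (by simp)) z
  obtain ⟨C, hC⟩ := (isCompact_closedBall z₁ δ₁).exists_bound_of_continuousOn
    ((hG.continuous_fderiv (by simp)).continuousOn)
  -- a radius `ε'` about `z₂`
  have hcont_a : ContinuousAt (fun ζ => (e.symm (G ζ)).1) z₂ :=
    continuousAt_fst.comp ((e.continuousAt_symm hxt).comp hG.continuous.continuousAt)
  have hev : ∀ᶠ ζ in 𝓝 z₂, ‖(e.symm (G ζ)).1 - z₁‖ < δ₁ / 32 := by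
    have h := Metric.tendsto_nhds.1 hcont_a (δ₁ / 32) (by positivity)
    simp only [hsx, dist_eq_norm] at h
    exact h
  obtain ⟨ε₂, hε₂, hε₂b⟩ := Metric.eventually_nhds_iff_ball.1 hev
  set ε' : ℝ := min (ε / 2) (min (ε₂ / 2) (min (R / 2) (η / 2))) with hε'_def
  have hε' : 0 < ε' := by positivity
  have hε'ε : ε' ≤ ε := by
    have := min_le_left (ε / 2) (min (ε₂ / 2) (min (R / 2) (η / 2))); linarith
  have hε'ε₂ : ε' < ε₂ := by
    have := (min_le_right (ε / 2) _).trans (min_le_left (ε₂ / 2) (min (R / 2) (η / 2)))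
    linarith
  have hε'R : ε' ≤ R := by
    have := (min_le_right (ε / 2) _).trans ((min_le_right (ε₂ / 2) _).trans
      (min_le_left (R / 2) (η / 2)))
    linarith
  have hε'η : ε' ≤ η := by
    have := (min_le_right (ε / 2) _).trans ((min_le_right (ε₂ / 2) _).trans
      (min_le_right (R / 2) (η / 2)))
    linarith
  have hS₂R : closedBall z₂ ε' ⊆ closedBall z₂ R := closedBall_subset_closedBall hε'R
  have hvt' : ∀ ζ ∈ closedBall z₂ ε', G ζ ∈ e.target := fun ζ hζ =>
    hvt ζ (closedBall_subset_ball (by linarith) hζ)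
  have hcne : ∀ ζ : ℂ, ‖ζ - z₂‖ = ε' → (e.symm (G ζ)).2 ≠ 0 := fun ζ hζ =>
    hne ζ (by rw [hζ]; exact hε') (by rw [hζ]; exact hε'ε)
  have hwind' : wind (fun t => (e.symm (G (circleLoop z₂ ε' t))).2) ≠ 0 :=
    (hwind ε' hε' hε'ε).ne'
  have ha : ∀ ζ ∈ closedBall z₂ ε', ‖(e.symm (G ζ)).1 - z₁‖ < δ₁ / 32 := fun ζ hζ =>
    hε₂b ζ (closedBall_subset_ball hε'ε₂ hζ)
  -- persistence
  have key := eventually_exists_eq_of_wind_ne_zero e (hsymm.of_le (by simp)) hδ₁ hbsrc hbd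
    (fun z hz => hC z hz) (hu₁.mono hD₁R) (hdu₁.mono hD₁R)
    (hud.mono fun n hn z hz => hn z (hD₁R hz)) hε' hvt'
    (hG.continuous.continuousOn) hcne hwind' ha (hu₂.mono hS₂R)
    (huc.mono fun n hn => hn.mono hS₂R)
  filter_upwards [key] with n ⟨ζ', hζ', ζ, hζ, heq⟩
  refine ⟨ζ', ζ, ?_, ?_, heq⟩
  · rw [mem_closedBall, dist_eq_norm] at hζ'
    exact hζ'.trans hε'η
  · rw [mem_ball, dist_eq_norm] at hζ
    exact hζ.trans hδ₁η

end Literature.Geometry.Symplectic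

end
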